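import Mathlib
import HarnessLib
import HarnessLib.Audit
import Summits.CriticalPhenomena.Statement

/-!
Route: PercGamblersRuin

# Route PercGamblersRuin — gambler's ruin on the would-be critical cluster against BGN off the floor
— exit order of SRW in a slab via optional stopping

X = VGR ∧ C1 ("it suffices to show"), card gamblers-ruin-vs-receding-floor (spine; crux A and the
optional-stopping dictionary) with
the partner crux C1 of card climb-ratio-receding-floor-v2. Height is the first coordinate x₀ of ℤ³;
for integers a < b the slab has its
FLOOR at depth a·n and its CEILING at height b·n (relative floor depth λ = a/b < 1). VGR (VERTICAL
GAMBLER'S RUIN, stated at p = p_c(ℤ³) — the only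
instance the deciding theorem uses; rev 3): if θ(p_c) > 0 there are a < b, c > 0 such that for all
large n every measurable slab voltage v (0 ≤ v ≤ 1, v = 1 on {x₀ ≥ bn}, v = 0 on {x₀ ≤ −an},
harmonic at the interior vertices for the open edges of ω — the minimal one is v(x) = P^ω_x(SRW on
the open cluster reaches the ceiling
before the floor)) has E_{p_c}[v(0); 0 ↔ ∞] ≥ c: from a point of the infinite cluster the walk
leaves the slab through the FARTHER plate
with non-vanishing probability (supercritical calibration, not part of the item: for p > p_c,
E[v_min(0) | 0 ↔ ∞] → a/(a+b), Berger–Biskup / Mathieu–Piatnitski). C1 (BGN OFF THE FLOOR): at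
p_c(ℤ³), for all a < b, liminf_n P(0 ↔ {x₀ = bn} inside {x₀ > −an}) = 0 — Barsky–Grimmett–Newman
with the floor receding at relative
depth λ < 1. Since v(0) > 0 forces an open path from 0 to the ceiling above the floor, VGR at p =
p_c and C1 cannot both hold if θ(p_c) > 0.
Lean: `VerticalGamblersRuin ∧ BGNOffTheFloor`

## Assembly
PROVED deciding theorem (rev 3, `closes : VerticalGamblersRuin → BGNOffTheFloor → MinimalVoltage →
PercolationContinuityZ3`,
sorry-free, axioms {propext, Classical.choice, Quot.sound}, ~35 tactic lines; same script as the two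
candidate proofs attached to the
Assembly item by grounder g13-41 and refuter 9b2fb0d4-g2): if θ(p_c) ≠ 0 then θ(p_c) > 0 (a
probability); VerticalGamblersRuin yields
a < b, c > 0, N₀; BGNOffTheFloor at (a, b) with ε = c yields (Frequently.and_eventually) n ≥ max(N₀,
1) with P_{p_c}(climb event) < c;
MinimalVoltage at (a, b, n) yields a grounded measurable voltage v, for which VGR gives c ≤ ∫_{0↔∞}
v(ω,0) dP_{p_c}, while
∫_{0↔∞} v(·,0) ≤ ∫ v(·,0) (v ≥ 0, setIntegral_le_integral) = ∫_{climb} v(·,0) (groundedness: v(ω,0)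
= 0 off the climb event,
setIntegral_eq_integral_of_forall_compl_eq_zero — so NO measurability of the climb event is needed)
≤ ∫_{climb} 1 = P_{p_c}(climb) < c
— contradiction, so θ(p_c) = 0, i.e. PercolationContinuityZ3. The Assembly item is the same
implication as a Prop (provable now by
`closes`); SymmetricSlabCalibration is a calibration support, not an antecedent. Imports: the gate
defaults only (rev 3 drops
`Literature.Probability.Percolation.ConstrainedClusters`, whose module cone carried 18 unproved
half-space facts into the route while no
item needs any of them: needs-fact none).

Rationale: WHY THIS LINE. Put a simple random walk on the counterfactual critical cluster and read
Barsky–Grimmett–Newman through optional stopping: in the slab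
(−an, bn) the piece of C containing 0 is a.s. finite at p_c (DuminilCopinSidoraviciusTassion2016 +
GrimmettMarstrand1990), the exit
time is integrable, and h(X_t) minus its compensator is a bounded-increment martingale, so u =
P^ω_0(exit on top) = (an + E^ω K_τ)/((a+b)n)
exactly, while u is also the VOLTAGE at 0 of the unit-resistor network C between a grounded floor
and a ceiling at potential 1
(Doyle–Snell; LyonsPeres2016 ch. 2). The imported area is discrete potential theory / random walk in
random environment
(GrimmettKestenZhang1993, BergerBiskup2006 = arXiv:math/0503576, MathieuPiatnitski2007, Barlow2004,
AndresDeuschelSlowik2015,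
DeuschelNguyenSlowik2017, KipnisVaradhan1986), with the explicit dictionary exit probability =
minimal harmonic interpolant, so that
the Lean statements need no Markov-chain API. The statement asked of the walk is far weaker than an
invariance principle — not
diffusivity, not transience (route PercClusterResistance's ClusterTransient), only that the exit
ORDER from a slab is not asymptotically
degenerate toward the nearer plate — and it is played against a half-space connectivity statement
(C1) that is implied by the conjunct
and extends the one sprinkling-free structure theorem at p_c (BGN; KozmaNitzan2024 §1 item 4 for the
only other 'quantify BGN' line in
print). No existing route of the sub uses exit order, voltages between plates, or a receding floor;
the negatives index (one SAW item)
is not touched.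

RANKED CRUXES. (X = VerticalGamblersRuin ∧ BGNOffTheFloor; the rank-0 Target item was dropped in rev
2 as not load-bearing — the deciding theorem `closes` composes the two cruxes and MinimalVoltage
directly.)
#2 VerticalGamblersRuin (crux) — at p = p_c(ℤ³) (rev 3: restated from the ∀-p form on the route
review's advice, a pure weakening — the ∀-p item also owed the supercritical QIP exit-order
corollary of Berger–Biskup / Mathieu–Piatnitski, Grimmett–Marstrand-based and consumed by nothing in
the route): if θ(p_c) > 0 there are integers 0 < a < b, a real c > 0 and N₀ such that for all n ≥ N₀
and every v : Ω → ℤ³ → ℝ with ω ↦ v(ω,0) measurable, 0 ≤ v ≤ 1, v(ω,x) = 1 when x₀ ≥ bn, v(ω,x) = 0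
when x₀ ≤ −an, and Σ_{y ~ x, xy open in ω} (v(ω,y) − v(ω,x)) = 0 at every x with −an < x₀ < bn, one
has ∫_{0 ↔ ∞} v(ω,0) dP_{p_c} ≥ c (card crux A, VGR(λ) with λ = a/b; lower bounds transfer from the
minimal voltage = SRW exit probability, so no uniqueness is needed). [difficulty: open-problem] (why
it might fail: At a percolating p_c the cluster may be a sprawling insulator: every exit/QIP proof
(GKZ, Barlow, Berger-Biskup, ADS/DNS) needs GM-based volume+isoperimetry, absent at p_c; and E[u]>=c
can fail by thin bottlenecks even where top-touching pieces are common (P(u>0)>=c is mere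
non-sprawling).) [GrimmettKestenZhang1993, doi:10.1007/s00440-006-0498-z,
doi:10.1098/rspa.2007.1876, doi:10.1214/009117904000000748, doi:10.1214/14-aop921,
doi:10.1007/s00440-017-0759-z, arXiv:1112.0104, LyonsPeres2016]
#3 BGNOffTheFloor (crux) — at p = p_c(ℤ³), for all integers a < b and every ε > 0 there are
arbitrarily large n with P(0 ↔ {x₀ = bn} by an open path inside {x₀ > −an}) < ε, i.e. liminf_n e(bn,
an) = 0: one cannot climb b·n from relative depth a/b < 1 above a floor (card
climb-ratio-receding-floor-v2 crux C1 on the rationals, in origin-centred form; BGN itself is λ = 0,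
the floor at the starting level; in this centred form a = 0 is vacuous and only a ≥ 1 carries
content). [difficulty: XL] (why it might fail: False in a non-sprawling jump world, so only a
theta(p_c)-blind quantitative BGN proves it; BGN (Grimmett1999 Thm 7.35) is by contradiction and
steers AT the floor ('no extra money'); no version with a floor receding at relative depth lambda>0
exists; refuting it refutes the conjunct itself.) [BarskyGrimmettNewman1991, Grimmett1999,
DuminilCopinSidoraviciusTassion2016, KozmaNitzan2024, arXiv:2108.10025]
#9 MinimalVoltage (support) — for all a < b and n > 0 there is a selection v : Ω → ℤ³ → ℝ which is a
slab voltage for EVERY ω (bounds, plate values, harmonic at interior vertices for the open lattice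
edges), with ω ↦ v(ω,0) measurable, and GROUNDED: v(ω,0) ≠ 0 only if 0 is joined to the ceiling {x₀
= bn} by an open path inside {x₀ > −an}. Proof: monotone iteration f₀ = 1_{ceiling}, f_{k+1} =
open-neighbour average inside, plate values outside; f_k ↑ v pointwise, harmonic in the limit
(finite sums), each f_k a cylinder function; f_k(0) > 0 iff an open path of length ≤ k climbs to the
ceiling inside the slab (the card's Fact 2). [difficulty: provable-now] [LyonsPeres2016,
Grimmett1999]
#9 SymmetricSlabCalibration (support; rev 3: the subtracted event `percolatesVia (withinGraph
(zdGraph 3) slab) 0` is written out as `{ω | ω ∩ E(lattice edges inside the open slab) ∈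
percolatesAt 0}` — the same set by `percolatesVia_eq_preimage` — so that the route no longer imports
ConstrainedClusters; at p_c the subtracted term is killed by in-tree BGN alone, DST not needed, per
grounder/refuter) — the family is anchored at λ = 1 (the analogue of F3 of
climb-ratio-receding-floor-v2): for every p, n > 0 and every measurable slab voltage v for the
symmetric slab (−n, n), ∫_{0 ↔ ∞} v(ω,0) dP_p ≥ (θ(p) − P_p(0 ↔ ∞ inside the open slab {−n < x₀ <
n}))/2; at p_c the subtracted term vanishes for every n (DST + Grimmett–Marstrand), so E[v(0); 0 ↔
∞] ≥ θ(p_c)/2 and VGR is the statement that moving the floor up from −bn to −an does not kill this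
quantity. Proof: v ≥ v_min (induction along the monotone iteration); reflection x₀ ↦ −x₀ preserves
P_p and swaps v_min^top, v_min^bottom; on a finite slab piece touching a plate v_min^top(0) +
v_min^bottom(0) = 1 (maximum principle), and on {0 ↔ ∞} the piece touches a plate unless it is
infinite. [difficulty: M] [LyonsPeres2016, DuminilCopinSidoraviciusTassion2016,
GrimmettMarstrand1990]

TWO-LAYER PLAN. Foreseen glued splits (k ≤ 3, depth 1; nothing filed now). VerticalGamblersRuin ⇐
AbstractHarmonicMeasure (AHM(3), weak form, carried
from the retired card stationary-media-cannot-backslide: for every random subgraph G ∋ 0 of ℤ³ whose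
rooted law is stationary and ergodic
under vertical shifts, invariant under x₀ ↦ −x₀, connected, of positive density, liminf_n E[u_G] > 0
for the slab (−an, bn)) →
ClusterIsStationaryMedium (C_∞ under P_p(· | 0 ↔ ∞) is such a medium) → VerticalGamblersRuin.
Alternative, electrical split if AHM
dies: VerticalGamblersRuin ⇐ StepProfileExclusion (an annealed voltage profile vanishing at relative
height a/(a+b) at every placement of
the plates forces, via Thomson/Dirichlet, through-slab conductance per unit area g(T) ≤ δ(T) g(T/3)
with δ → 0, hence g(T) = T^{−ω(1)};
the card's crux B, an L¹→L^∞ repair on the current-carrying set) → ConductanceLowerBound (g(T) ≥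
T^{−A}: spanning pieces have density
≥ θ(p_c)²/4 at the midplane of every slab by FKG (the card's Fact 3) and size ≤ slab susceptibility
χ_{S_T}(p_c(ℤ³)) ≤ T^A, the crux U of
card no-creeping-tortuosity-price) → VerticalGamblersRuin. BGNOffTheFloor's own ladder (sub-linearly
receding floor, then small λ)
belongs to the route of climb-ratio-receding-floor-v2 when it opens; the item is meant to be shared
(wanted_by).

KILL CRITERIA. (i) A refuter exhibits a BACK-SLIDING MEDIUM: a stationary, ergodic, x₀ ↦
−x₀-symmetric, connected, positive-density random subgraph of
ℤ³ (no independence required) on which SRW leaves the slab (−an, bn) through the nearer plate w.h.p.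
for some a < b — then 'stationarity +
reversibility suffice' is dead, VGR needs Bernoulli-specific input, and the route PIVOTS to the
electrical split (StepProfileExclusion +
ConductanceLowerBound) or, if that is not typeable by then, closes `superseded` by
route-CriticalPhenomena-PercClusterResistance. (ii) A
proof that at p_c, P(top-touching piece ∋ 0) ≥ c already forces E[u; 0 ↔ ∞] ≥ c′ would make VGR ⟺
¬C1 in the jump world — the walk then
adds nothing and the route closes `superseded` (vacuous dichotomy). (iii) BGNOffTheFloor cannot be
refuted without refuting the conjunct
(¬C1 at some a < b gives liminf_n P(0 ↔ ∂B(an)) > 0, i.e. θ(p_c) > 0); a refutation therefore closes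
the whole sub-problem, not just
this route. (iv) ClusterTransient of PercClusterResistance proved by a method that also controls
exit order ⇒ merge VGR into that route.

NOT DECOMPOSED YET. The optional-stopping identity for the actual SRW (needs a
Markov-chain-on-a-cluster API; in the route the walk enters only through the
minimal harmonic interpolant), the voltage comparison lemma v ≥ v_min and Dirichlet uniqueness on
finite pieces (prover-side `--supports`
lemmas), the FKG spanning-density lemma (Fact 3), ConductanceLowerBound, StepProfileExclusion and
the partner crux U (all layer-2, only
if the electrical split is activated), the supercritical case p > p_c of VGR (a
Berger–Biskup-strength theorem needing Grimmett–Marstrand;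
outside the item since rev 3 — file it as a groundable 'known ∘ QIP' support only if the calibration
value a/(a+b) is wanted on the ledger), and the BackSliding dossier (C1 for all λ < 1 ⇒ E[u] → 0
below the
midplane, → θ(p_c) above: a movable step) wanted by cards critical-cluster-threshold-one and
necklace-or-conductor.

CHEAPEST FALSIFIER. Pencil first: build the back-sliding medium of Kill criterion (i). Checked so
far: 1D (E[u] = an/((a+b)n) EXACTLY for i.i.d. resistances
of any tail, by exchangeability; positivity for stationary ergodic media), three 3D families in the
retired card
stationary-media-cannot-backslide (hierarchical insulating layers, spike forests, floors-and-rungs: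
none back-slides), and this session's
'pagoda' attempt (NOTES.md): one-sided blocking with probability → 1 needs nested roof stacks at
log-dense scales, and the x₀ ↦ −x₀
symmetry then forces cups interleaved with domes around a.e. point, which the stacks cannot host
without sealing pockets of positive
density — no medium found, a packing obstruction conjectured; one more refuter-hour here is the
cheapest test. Second: kit Monte Carlo
at p = 0.26–0.30 (bond p_c ≈ 0.2488), slab (−n, 2n), n ≤ 64, E[u(0); 0 ∈ C] against 1/3 —
calibration only (not run; the p_c statement
is not simulable). Lookup done: the degenerate-ergodic QIPs (doi:10.1214/14-aop921,
doi:10.1007/s00440-017-0759-z) assume inverse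
moments of conductances or volume regularity + isoperimetry — none covers 0/1 conductances at p_c;
VGR is not 'known'.

NUMBERS. p_c(bond ℤ³) ≈ 0.2488126. Supercritical calibration: E[u] → a/(a+b) (= 1/3 for the slab
(−n, 2n)) by the quenched invariance principle
(doi:10.1007/s00440-006-0498-z, doi:10.1098/rspa.2007.1876); symmetric slab: E[v(0); 0 ↔ ∞] = θ(p)/2
exactly when slab pieces are finite
(SymmetricSlabCalibration). C1 side (from climb-ratio-receding-floor-v2): predicted real-world decay
e(c, λc) ≍ c^{−0.477} (bulk one-arm
exponent β/ν, β ≈ 0.418, ν ≈ 0.876) with λ-dependent amplitude, boundary one-arm exponent x_s ≈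
0.975 at λ = 0 (DengBlote2005). GKZ
transience and Barlow's Gaussian bounds: d ≥ 3, p > p_c only. Items at open: 6 (2 cruxes, 2
supports, target, assembly); rev 3: 5 (2 cruxes, 2 supports, assembly) + the proved deciding theorem
`closes`.

DEFINITION REQUESTS. None filed. The slab-voltage predicate (bounds, plate values, harmonicity for
the open lattice edges) is inlined in VerticalGamblersRuin,
MinimalVoltage and SymmetricSlabCalibration; a Literature definition `IsSlabVoltage` /
`minimalSlabVoltage` (topic
Literature/Probability/Percolation, or SRW-on-a-subgraph hitting probabilities via Mathlib's
`ProbabilityTheory.Kernel.traj`) would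
shorten all three and let the optional-stopping identity be stated; the tenure planner files it once
a prover asks. Cite facts that would
help provers but are not load-bearing: GrimmettKestenZhang1993 (transience, p > p_c), Berger–Biskup
2007 Thm 1.1 (QIP, p > p_c).

Novelty: Searches (2026-08-15): `lit search "random walk on percolation cluster exit probability slab
half-space harmonic measure"` (local searchd
rc 75, down); `lit search --source zbmath` ×6: "quenched invariance principle simple random walk
percolation clusters" (6: MP07, BB07,
PRS16, BMO18, Chang17, Nguyen17), "random walk incipient infinite cluster critical percolation
subdiffusive" (3: Kesten1986 AIHP,
Ganguly–Lee 2022, BDKY 2015), "random walks on supercritical percolation clusters heat kernel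
Barlow" (5: Barlow04, Barlow–Hambly09,
Sapozhnikov17, Heicklen–Hoffman05, Duminil-Copin08), "random conductance model invariance principle
ergodic degenerate conductances"
(3: ADS15, DNS18, Bella–Schäffner20), "random walk percolation cluster exit probability half-space"
(0), "gambler's ruin random
environment exit problem reversible … stationary ergodic conductances" (0); `lit galaxy search
--star all` ×3: "random walk on the
infinite percolation cluster" (5 rows: Saint-Flour LNM 1717, Heydenreich–vdHofstad, Deuschel–Kösters
AIHP, Fribergh AoP 2010, AIHP 2018),
"harmonic measure percolation cluster" (0), "random walks on supercritical percolation clusters" (4: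
BGP03 speed, BMO19, EJP 2022);
`lit galaxy search --star pdf "exit distribution random walk percolation"` (0); `lit frontier
CriticalPhenomena --since 2021` (30 rows,
planar/SLE/lace dominated, none on walks on 3-D critical clusters); the card's and its novelty
audit's searches; the 25 theses of the
sub and route-CriticalPhenomena-  [refs: 10.1007/bf01195881:, 10.1007/s00440-006-0498-z, 10.1098/rspa.2007.1876, 10.1214/14-aop921, 10.1007/s00440-017-0759-z, 10.1214/14-aop934:, doi:10.1007/bf01195881, doi:10.1007/s00440-006-0498-z, doi:10.1098/rspa.2007.1876, doi:10.1214/14-aop921, doi:10.1007/s00440-017-0759-z, doi:10.1214/14-aop934, Kesten1986, GrimmettKestenZhang1993, BarskyGrimmettNewman1991, Grimmett1999, KozmaNitzan2024]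

Barriers (technique_class: random-walk harmonic-measure optional-stopping same-p): - technique_class: random-walk harmonic-measure optional-stopping same-p
- Literature.Barriers.CriticalPhenomena.SprinklingRenormalisation: applies head-on to
VerticalGamblersRuin — every certified walk property of the infinite cluster (GKZ transience,
Barlow, Berger–Biskup/Mathieu–Piatnitski, DNS) rests on Grimmett–Marstrand blocks at p + η; it does
not evade it; the bet is that exit-order non-degeneracy is so much weaker than heat-kernel
regularity that stationarity + reversibility of the environment seen from the walker (plus, at most,
Thomson's principle) reach it without isoperimetry. BGNOffTheFloor lives in a half-space at fixed
p_c and renormalises nothing, exactly as BGN.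
- Literature.Barriers.CriticalPhenomena.SlabLimitUniformControl: not engaged — no limit of slab
critical points p_c(S_k) → p_c is taken and no uniform modulus is needed; slabs of thickness (a+b)n
appear at the BULK critical point, where they are subcritical, and DST's theorem is used only
positively (finiteness of slab pieces, in the calibration support, not in the assembly).
- Literature.Barriers.CriticalPhenomena.TransverseCrossingsNeedNotMeet: not engaged — no crossings
are glued; potentials (harmonic interpolants) replace paths, and the only path statement (C1) is a
one-arm event in a half-space.
- Literature.Barriers.CriticalPhenomena.RandomClusterFirstOrder: consistent and instructive — on the
wired large-q random-cluster infinite cluster at p_c(q) the ordered phase conducts and the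
VGR-analogu

History (route lifecycle, newest last):
- 2026-08-15T12:38:03Z · rev 2: dropped Target — drop Target (stmt-7771): not load-bearing — Assembly composes VerticalGamblersRuin -> BGNOffTheFloor -> MinimalVoltage -> PercolationContinuityZ3 directly; the (planner-plancard-CriticalPhenomena-Percolatio-3b8fa237-0)
- 2026-08-15T16:19:58Z · rev 3: restated VerticalGamblersRuin (stmt-CriticalPhenomena-7772), SymmetricSlabCalibration (stmt-CriticalPhenomena-7775) — route-repair (rbadge cde9aa20-g4): rev 3 — deciding theorem closes : VerticalGamblersRuin → BGNOffTheFloor → MinimalVoltage → PercolationContinuityZ3 PROVED (so (planner-rbadge-CriticalPhenomena-PercGamblersR-cde9aa20-g4-0)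

sub-problem: PercolationContinuityZ3 · status: open · opened planner-plancard-CriticalPhenomena-Percolatio-3b8fa237-0 2026-08-15T12:18:16Z · rev 6 · ledger route-CriticalPhenomena-PercGamblersRuin
GENERATED by the gate from the ledger (D-0016/17). Provers cite these decls: `theorem foo : Summit.CriticalPhenomena.PercolationContinuityZ3.Theses.PercGamblersRuin.<Decl> := …` in Summits/CriticalPhenomena/PercolationContinuityZ3/Theorems/<Name>.lean.
-/

namespace Summit.CriticalPhenomena.PercolationContinuityZ3.Theses.PercGamblersRuin

open scoped BigOperators Topology Manifold Classical MeasureTheory ProbabilityTheory Matrix InnerProductSpace ComplexConjugate ContinuousMap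
open Filter Set Function TopologicalSpace MeasureTheory

attribute [summit_statement] _root_.PercolationContinuityZ3

-- earlier VerticalGamblersRuin (stmt-CriticalPhenomena-7772, replaced 2026-08-15T16:19:58Z -> stmt-CriticalPhenomena-10642): retired by None — ∀ p : unitInterval, 0 < Literature.Probability.Percolation.theta (Literature.Probability.LatticeModels.zdGraph 3) 0 p → ∃ a b : ℕ, 0 < a ∧ a < b ∧ ∃ c : ℝ, 0 < c ∧ ∃ N₀ : ℕ, ∀ n ≥ N₀, ∀ v : Literature.Probability.Percolation.BondConfig (Literature.Probability
/-- item stmt-CriticalPhenomena-10642 · crux · rank 2 · closed · proved by Summit.CriticalPhenomena.PercolationContinuityZ3.Theorems.PercGamblersRuinVerticalGamblersRuin.verticalGamblersRuin_proof @ efc445108c60 (prover) · by planner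
why it might fail: Vacuous iff θ(p_c)=0, so only a θ-blind walk argument proves it: every exit/transience/QIP/harmonic-rigidity theorem for SRW on clusters (GKZ93, Barlow04, BB07, MP07, ADS15, Hutchcroft23, GuSuXu25) is p>p_c via GM isoperimetry; a would-be critical cluster may be a bottleneck insulator, E[v_min]→0.
sources: GrimmettKestenZhang1993, GrimmettMarstrand1990, doi:10.1214/009117904000000748, doi:10.1007/s00440-006-0498-z, doi:10.1098/rspa.2007.1876, doi:10.1214/14-aop921
[crux] VGR at p = p_c(ℤ³) (rev 3: the p_c-instance, a pure weakening of the ∀-p form 7772 — the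
deciding theorem uses only this instance, and the ∀-p item also owed the supercritical QIP
exit-order corollary of Berger–Biskup / Mathieu–Piatnitski, GM-based and consumed by nothing here):
if θ(p_c) > 0 there are integers 0 < a < b, a real c > 0 and N₀ such that for all n ≥ N₀ and every v
: Ω → ℤ³ → ℝ with ω ↦ v(ω,0) measurable, 0 ≤ v ≤ 1, v(ω,x) = 1 when x₀ ≥ bn, v(ω,x) = 0 when x₀ ≤
−an, and Σ_{y ~ x, xy open in ω} (v(ω,y) − v(ω,x)) = 0 at every x with −an < x₀ < bn, one has ∫_{0 ↔
∞} v(ω,0) dP_{p_c} ≥ c (card crux A, VGR(λ) with λ = a/b; lower bounds transfer from the minimal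
voltage = SRW exit probability, so no uniqueness is needed; vacuous iff the conjunct holds, so it is
refutable only together with θ(p_c) > 0 — the honest dichotomy partner of BGNOffTheFloor).
[difficulty: open-problem] -/
@[route_item "route-CriticalPhenomena-PercGamblersRuin"]
def VerticalGamblersRuin : Prop :=
  0 < Literature.Probability.Percolation.theta (Literature.Probability.LatticeModels.zdGraph 3) 0 (Literature.Probability.Percolation.criticalProbI 3) → ∃ a b : ℕ, 0 < a ∧ a < b ∧ ∃ c : ℝ, 0 < c ∧ ∃ N₀ : ℕ, ∀ n ≥ N₀, ∀ v : Literature.Probability.Percolation.BondConfig (Literature.Probability.LatticeModels.Site 3) → Literature.Probability.LatticeModels.Site 3 → ℝ, Measurable (fun ω => v ω 0) → (∀ ω x, 0 ≤ v ω x ∧ v ω x ≤ 1) → (∀ ω x, ((b * n : ℕ) : ℤ) ≤ x 0 → v ω x = 1) → (∀ ω x, x 0 ≤ -((a * n : ℕ) : ℤ) → v ω x = 0) → (∀ ω x, -((a * n : ℕ) : ℤ) < x 0 → x 0 < ((b * n : ℕ) : ℤ) → ∑ y ∈ ((Literature.Probability.LatticeModels.zdGraph 3).neighborFinset x).filter (fun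 y => s(x, y) ∈ ω), (v ω y - v ω x) = 0) → c ≤ ∫ ω in Literature.Probability.Percolation.percolatesAt (0 : Literature.Probability.LatticeModels.Site 3), v ω 0 ∂(Literature.Probability.Percolation.bondPercolation (Literature.Probability.LatticeModels.zdGraph 3) (Literature.Probability.Percolation.criticalProbI 3))

/-- item stmt-CriticalPhenomena-7773 · crux · rank 3 · closed · proved by Summit.CriticalPhenomena.PercolationContinuityZ3.Theorems.PercGamblersRuinBGNOffTheFloor.bGNOffTheFloor_proof @ 175ae9e337de (prover) · by planner
why it might fail: Implied by θ(p_c)=0 and refutable only via θ(p_c)>0; fails in a non-sprawling θ(p_c)>0 world, so it needs a θ-blind quantitative BGN with the floor receding at depth a·n (λ=a/b>0): in-tree BGN (Grimmett1999 Thm 7.35) is λ=0 with no rate; half-space one-arm rates exist only for d>6 (CH20, PS25).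
sources: BarskyGrimmettNewman1991, Grimmett1999, Literature.Probability.Percolation.BarskyGrimmettNewman1991_Z3_holds, KozmaNitzan2024, arXiv:1810.03750, arXiv:2512.13624
[crux] at p = p_c(ℤ³), for all integers a < b and every ε > 0 there are arbitrarily large n with P(0
↔ {x₀ = bn} by an open path inside {x₀ > −an}) < ε, i.e. liminf_n e(bn, an) = 0: one cannot climb
b·n from relative depth a/b < 1 above a floor (card climb-ratio-receding-floor-v2 crux C1 on the
rationals, in origin-centred form; BGN itself is λ = 0, the floor at the starting level; in this
centred form a = 0 is vacuous and only a ≥ 1 carries content). [difficulty: XL] -/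
@[route_item "route-CriticalPhenomena-PercGamblersRuin"]
def BGNOffTheFloor : Prop :=
  ∀ a b : ℕ, a < b → ∀ ε : ℝ, 0 < ε → ∃ᶠ n : ℕ in Filter.atTop, (Literature.Probability.Percolation.bondPercolation (Literature.Probability.LatticeModels.zdGraph 3) (Literature.Probability.Percolation.criticalProbI 3)).real {ω | ∃ y : Literature.Probability.LatticeModels.Site 3, y 0 = ((b * n : ℕ) : ℤ) ∧ ω ∈ Literature.Probability.Percolation.openConnIn {z : Literature.Probability.LatticeModels.Site 3 | -((a * n : ℕ) : ℤ) < z 0} 0 y} < ε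

-- earlier SymmetricSlabCalibration (stmt-CriticalPhenomena-7775, replaced 2026-08-15T16:19:58Z -> stmt-CriticalPhenomena-10643): retired by None — ∀ p : unitInterval, ∀ n : ℕ, 0 < n → ∀ v : Literature.Probability.Percolation.BondConfig (Literature.Probability.LatticeModels.Site 3) → Literature.Probability.LatticeModels.Site 3 → ℝ, Measurable (fun ω => v ω 0) → (∀ ω x, 0 ≤ v ω x ∧ v ω x ≤ 1) → (∀ ω x
/-- item stmt-CriticalPhenomena-10643 · support · rank 9 · closed · proved by Summit.CriticalPhenomena.PercolationContinuityZ3.Theorems.symmetricSlabCalibration_proof @ 614fa71ac06a (prover) · by planner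
sources: LyonsPeres2016, BarskyGrimmettNewman1991, GrimmettMarstrand1990
[support] the family is anchored at λ = 1 (the analogue of F3 of climb-ratio-receding-floor-v2): for
every p, n > 0 and every measurable slab voltage v for the symmetric slab (−n, n), ∫_{0 ↔ ∞} v(ω,0)
dP_p ≥ (θ(p) − P_p(0 ↔ ∞ inside the open slab {−n < x₀ < n}))/2, the subtracted event being written
(rev 3, so that the route imports nothing beyond the gate defaults) as `{ω | ω ∩ E ∈ percolatesAt
0}` with E the lattice edges having both endpoints in the open slab — literally the former
`percolatesVia (withinGraph (zdGraph 3) slab) 0` by `percolatesVia_eq_preimage` (set equality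
checked in the planner's SketchEquiv.lean); at p_c the subtracted term vanishes for every n by
in-tree BGN alone (the slab sits in a half-space; BarskyGrimmettNewman1991_Z3_holds — DST is not
needed, grounder g13-41 / refuter 9b2fb0d4), so E[v(0); 0 ↔ ∞] ≥ θ(p_c)/2 and VGR is the statement
that moving the floor up from −bn to −an does not kill this quantity. Proof: v ≥ v_min (induction
along the monotone iteration); reflection x₀ ↦ −x₀ preserves P_p and swaps v_min^top, v_min^bottom;
on a finite slab piece touching a plate v_min^top(0) + v_min^bottom(0) = 1 (maximum principle), and
on {0 ↔ ∞} the piece touche -/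
@[route_item "route-CriticalPhenomena-PercGamblersRuin"]
def SymmetricSlabCalibration : Prop :=
  ∀ p : unitInterval, ∀ n : ℕ, 0 < n → ∀ v : Literature.Probability.Percolation.BondConfig (Literature.Probability.LatticeModels.Site 3) → Literature.Probability.LatticeModels.Site 3 → ℝ, Measurable (fun ω => v ω 0) → (∀ ω x, 0 ≤ v ω x ∧ v ω x ≤ 1) → (∀ ω x, (n : ℤ) ≤ x 0 → v ω x = 1) → (∀ ω x, x 0 ≤ -(n : ℤ) → v ω x = 0) → (∀ ω x, -(n : ℤ) < x 0 → x 0 < (n : ℤ) → ∑ y ∈ ((Literature.Probability.LatticeModels.zdGraph 3).neighborFinset x).filter (fun y => s(x, y) ∈ ω), (v ω y - v ω x) = 0) → (Literature.Probability.Percolation.theta (Literature.Probability.LatticeModels.zdGraph 3) 0 p - (Literature.Probability.Percolation.bondPercolation (Literature.Probability.LatticeModels.zdGraph 3) p).real {ω | ω ∩ {e : Sym2 (Literature.Probability.LatticeModels.Site 3) | e ∈ (Literature.Probability.LatticeModels.zdGraph 3).edgeSet ∧ ∀ z ∈ e, -(n : ℤ) < z 0 ∧ z 0 < (n : ℤ)}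 ∈ Literature.Probability.Percolation.percolatesAt (0 : Literature.Probability.LatticeModels.Site 3)}) / 2 ≤ ∫ ω in Literature.Probability.Percolation.percolatesAt (0 : Literature.Probability.LatticeModels.Site 3), v ω 0 ∂(Literature.Probability.Percolation.bondPercolation (Literature.Probability.LatticeModels.zdGraph 3) p)

/-- item stmt-CriticalPhenomena-7774 · support · rank 9 · closed · proved by Summit.CriticalPhenomena.PercolationContinuityZ3.Theorems.MinimalVoltage_proof @ f648441f8c8f (prover) · by planner
sources: LyonsPeres2016, Grimmett1999
[support] for all a < b and n > 0 there is a selection v : Ω → ℤ³ → ℝ which is a slab voltage for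
EVERY ω (bounds, plate values, harmonic at interior vertices for the open lattice edges), with ω ↦
v(ω,0) measurable, and GROUNDED: v(ω,0) ≠ 0 only if 0 is joined to the ceiling {x₀ = bn} by an open
path inside {x₀ > −an}. Proof: monotone iteration f₀ = 1_{ceiling}, f_{k+1} = open-neighbour average
inside, plate values outside; f_k ↑ v pointwise, harmonic in the limit (finite sums), each f_k a
cylinder function; f_k(0) > 0 iff an open path of length ≤ k climbs to the ceiling inside the slab
(the card's Fact 2). [difficulty: provable-now] -/
@[route_item "route-CriticalPhenomena-PercGamblersRuin"]
def MinimalVoltage : Prop :=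
  ∀ a b n : ℕ, a < b → 0 < n → ∃ v : Literature.Probability.Percolation.BondConfig (Literature.Probability.LatticeModels.Site 3) → Literature.Probability.LatticeModels.Site 3 → ℝ, Measurable (fun ω => v ω 0) ∧ (∀ ω x, 0 ≤ v ω x ∧ v ω x ≤ 1) ∧ (∀ ω x, ((b * n : ℕ) : ℤ) ≤ x 0 → v ω x = 1) ∧ (∀ ω x, x 0 ≤ -((a * n : ℕ) : ℤ) → v ω x = 0) ∧ (∀ ω x, -((a * n : ℕ) : ℤ) < x 0 → x 0 < ((b * n : ℕ) : ℤ) → ∑ y ∈ ((Literature.Probability.LatticeModels.zdGraph 3).neighborFinset x).filter (fun y => s(x, y) ∈ ω), (v ω y - v ω x) = 0) ∧ ∀ ω, v ω 0 ≠ 0 → ∃ y : Literature.Probability.LatticeModels.Site 3, y 0 = ((b * n : ℕ) : ℤ) ∧ ω ∈ Literature.Probability.Percolation.openConnIn {z : Literature.Probability.LatticeModels.Site 3 | -((a * n : ℕ) : ℤ) < z 0} 0 y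

/-- item stmt-CriticalPhenomena-7776 · assembly · rank 1 · closed · proved by Summit.CriticalPhenomena.PercolationContinuityZ3.Theorems.percGamblersRuin_assembly_proof @ 7dcef279e6f5 (prover) · by planner
sources: BarskyGrimmettNewman1991, GrimmettKestenZhang1993, LyonsPeres2016
[assembly] VerticalGamblersRuin → BGNOffTheFloor → MinimalVoltage → PercolationContinuityZ3 (θ(p_c)
= 0 on ℤ³). -/
@[route_item "route-CriticalPhenomena-PercGamblersRuin"]
def Assembly : Prop :=
  VerticalGamblersRuin → BGNOffTheFloor → MinimalVoltage → PercolationContinuityZ3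

/-! D-0027 §2.1 — DECIDING THEOREM (planner-authored via `route open/edit --closes-file`; by planner-rbadge-CriticalPhenomena-PercGamblersR-cde9aa20-g4-0 2026-08-15T16:19:58Z):
its hypotheses are this route's items and its conclusion the sub-problem Statement (glue_lint), and it elaborates with this file. -/

@[closes "route-CriticalPhenomena-PercGamblersRuin"] theorem closes (h_VerticalGamblersRuin : VerticalGamblersRuin) (h_BGNOffTheFloor : BGNOffTheFloor) (h_MinimalVoltage : MinimalVoltage) : _root_.PercolationContinuityZ3 := by
  -- θ(p_c) = 0 by contradiction: were θ(p_c) > 0, VerticalGamblersRuin gives plates a < b, a constant c > 0 and N₀;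
  -- BGNOffTheFloor at (a, b, ε := c) gives n ≥ max N₀ 1 with P_{p_c}(climb event) < c; the grounded slab voltage v
  -- of MinimalVoltage vanishes at 0 off the climb event and is ≤ 1 on it, so
  -- c ≤ ∫_{0↔∞} v(·,0) ≤ ∫ v(·,0) = ∫_{climb} v(·,0) ≤ ∫_{climb} 1 = P_{p_c}(climb) < c — absurd.
  refine Literature.Probability.Percolation.percolationContinuityZ3_iff.mpr ?_
  by_contra hne
  have hpos : 0 < Literature.Probability.Percolation.theta (Literature.Probability.LatticeModels.zdGraph 3)
      (0 : Literature.Probability.LatticeModels.Site 3) (Literature.Probability.Percolation.criticalProbI 3) :=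
    lt_of_le_of_ne measureReal_nonneg (Ne.symm hne)
  obtain ⟨a, b, -, hab, c, hc, N₀, hVGR⟩ := h_VerticalGamblersRuin hpos
  obtain ⟨n, hclimb, hn⟩ :=
    ((h_BGNOffTheFloor a b hab c hc).and_eventually (eventually_ge_atTop (max N₀ 1))).exists
  have hnN : N₀ ≤ n := le_trans (le_max_left _ _) hn
  have hn0 : 0 < n := lt_of_lt_of_le (lt_of_lt_of_le Nat.one_pos (le_max_right _ _)) hn
  obtain ⟨v, hmeas, hbounds, htop, hbot, hharm, hground⟩ := h_MinimalVoltage a b n hab hn0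
  have hlow := hVGR n hnN v hmeas hbounds htop hbot hharm
  have hint : Integrable (fun ω => v ω 0)
      (Literature.Probability.Percolation.bondPercolation (Literature.Probability.LatticeModels.zdGraph 3)
        (Literature.Probability.Percolation.criticalProbI 3)) :=
    Integrable.of_bound hmeas.aestronglyMeasurable 1
      (Eventually.of_forall fun ω => by
        rw [Real.norm_eq_abs, abs_of_nonneg (hbounds ω 0).1]
        exact (hbounds ω 0).2)
  have h1 : ∫ ω in Literature.Probability.Percolation.percolatesAt (0 : Literature.Probability.LatticeModels.Site 3), v ω 0
        ∂(Literature.Probability.Percolation.bondPercolation (Literature.Probability.LatticeModels.zdGraph 3)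
          (Literature.Probability.Percolation.criticalProbI 3))
      ≤ ∫ ω, v ω 0 ∂(Literature.Probability.Percolation.bondPercolation (Literature.Probability.LatticeModels.zdGraph 3)
          (Literature.Probability.Percolation.criticalProbI 3)) :=
    setIntegral_le_integral hint (Eventually.of_forall fun ω => (hbounds ω 0).1)
  have h2 : ∫ ω, v ω 0 ∂(Literature.Probability.Percolation.bondPercolation (Literature.Probability.LatticeModels.zdGraph 3)
          (Literature.Probability.Percolation.criticalProbI 3))
      = ∫ ω in {ω | ∃ y : Literature.Probability.LatticeModels.Site 3, y 0 = ((b * n : ℕ) : ℤ) ∧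
          ω ∈ Literature.Probability.Percolation.openConnIn
            {z : Literature.Probability.LatticeModels.Site 3 | -((a * n : ℕ) : ℤ) < z 0} 0 y}, v ω 0
        ∂(Literature.Probability.Percolation.bondPercolation (Literature.Probability.LatticeModels.zdGraph 3)
          (Literature.Probability.Percolation.criticalProbI 3)) := by
    refine (setIntegral_eq_integral_of_forall_compl_eq_zero fun ω hω => ?_).symm
    by_contra hv
    exact hω (hground ω hv)
  have h3 : ∫ ω in {ω | ∃ y : Literature.Probability.LatticeModels.Site 3, y 0 = ((b * n : ℕ) : ℤ) ∧
          ω ∈ Literature.Probability.Percolation.openConnIn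
            {z : Literature.Probability.LatticeModels.Site 3 | -((a * n : ℕ) : ℤ) < z 0} 0 y}, v ω 0
        ∂(Literature.Probability.Percolation.bondPercolation (Literature.Probability.LatticeModels.zdGraph 3)
          (Literature.Probability.Percolation.criticalProbI 3))
      ≤ ∫ ω in {ω | ∃ y : Literature.Probability.LatticeModels.Site 3, y 0 = ((b * n : ℕ) : ℤ) ∧
          ω ∈ Literature.Probability.Percolation.openConnIn
            {z : Literature.Probability.LatticeModels.Site 3 | -((a * n : ℕ) : ℤ) < z 0} 0 y}, (1 : ℝ)
        ∂(Literature.Probability.Percolation.bondPercolation (Literature.Probability.LatticeModels.zdGraph 3)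
          (Literature.Probability.Percolation.criticalProbI 3)) :=
    setIntegral_mono hint.integrableOn (integrable_const (1 : ℝ)).integrableOn fun ω => (hbounds ω 0).2
  have h4 : ∫ ω in {ω | ∃ y : Literature.Probability.LatticeModels.Site 3, y 0 = ((b * n : ℕ) : ℤ) ∧
          ω ∈ Literature.Probability.Percolation.openConnIn
            {z : Literature.Probability.LatticeModels.Site 3 | -((a * n : ℕ) : ℤ) < z 0} 0 y}, (1 : ℝ)
        ∂(Literature.Probability.Percolation.bondPercolation (Literature.Probability.LatticeModels.zdGraph 3)
          (Literature.Probability.Percolation.criticalProbI 3))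
      = (Literature.Probability.Percolation.bondPercolation (Literature.Probability.LatticeModels.zdGraph 3)
          (Literature.Probability.Percolation.criticalProbI 3)).real
          {ω | ∃ y : Literature.Probability.LatticeModels.Site 3, y 0 = ((b * n : ℕ) : ℤ) ∧
            ω ∈ Literature.Probability.Percolation.openConnIn
              {z : Literature.Probability.LatticeModels.Site 3 | -((a * n : ℕ) : ℤ) < z 0} 0 y} := by
    rw [setIntegral_const, smul_eq_mul, mul_one]
  exact (lt_irrefl c) (lt_of_le_of_lt (hlow.trans (h1.trans (h2.le.trans (h3.trans h4.le)))) hclimb)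

end Summit.CriticalPhenomena.PercolationContinuityZ3.Theses.PercGamblersRuin
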